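import Summits.Parity.GeneralizedHardyLittlewood.Theorems.GreenTaoLevelTwoMNTwoLemma24Core

/-!
# Route `GreenTaoLevelTwo`, crux `MNTwo` (stmt-Parity-21276), line `birth`, stub `stub_mnVertical`:
# Lemma 24 in polynomial form from the Fourier expansion of the cutoff (GT 2008b §10, App. A)

The LAST BOOKKEEPING STEP for `stub_mnVertical` (B. Green, T. Tao, *Quadratic uniformity of the
Möbius function*, Ann. Inst. Fourier 58 (2008) = arXiv:math/0606087, §10 Lemma 24): the hypothesis
`hL` of `…MNTwoTypeIIHalf.typeII_half` ("Lemma 24 in polynomial form") follows from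
`…MNTwoLemma24Core.lemma24_core` and ONE remaining input, the Fourier expansion of Bohr-gauge
Lipschitz cutoffs (AIF Lemma 37, hypothesis `hfour`: `J ≤ Cf·δ^{-D}` characters `e(β_j n)` with
coefficients of norm `≤ 1`, accuracy `δ` on `B(n₀,3ρ)`).  Choice: `A₂ = 40448(D+1)`,
`C₂ = 10²⁰⁰·B^{1264}` with `B = 2^{D+1}Cf/c₁^{D+1}`, `c₁ = 1/(4096⁴3¹⁰)`.  Def-free.
After this file: `stub_mnVertical` ⟸ `hfour` for every `k`
(`…MNTwoVerticalOfLemma24.stub_mnVertical_of_lemma24 (fun k => lemma24_poly k (hfour k))`).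

* `lemma24_poly` — `hfour → «Lemma 24 in polynomial form»`.

References: [GreenTao2008QuadraticMobius] arXiv:math/0606087 §10 (Lemma 24), App. A Lemma 37.
-/

noncomputable section

open Finset
open scoped ComplexConjugate FourierTransform

namespace Summit.Parity.GeneralizedHardyLittlewood.GreenTaoLevelTwoMNTwoLemma24Poly

open Summit.Parity.GeneralizedHardyLittlewood.GreenTaoLevelTwoMNTwoLemma24Core (lemma24_core)

set_option maxHeartbeats 400000 in
set_option exponentiation.threshold 2000 in
/-- **Lemma 24 in polynomial form, from the Fourier expansion of the cutoff.**  See the module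
docstring. [cite: GreenTao2008QuadraticMobius, §10 (Lemma 24), App. A (Lemma 37)] -/
theorem lemma24_poly (k : ℕ)
    (hfour : ∃ (D : ℕ) (Cf : ℝ), 1 ≤ Cf ∧ ∀ (N : ℕ) (α : Fin k → ℝ) (n₀ : ℤ) (ρ : ℝ), 0 < ρ →
      ∀ (ψ : ℤ → ℝ), (∀ n, 0 ≤ ψ n) → (∀ n, ψ n ≤ 1) →
        (∀ n, ψ n ≠ 0 →
          (⨆ i : Fin k, ‖((((n - n₀ : ℤ) : ℝ) * α i : ℝ) : AddCircle (1 : ℝ))‖) +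
            |((n - n₀ : ℤ) : ℝ)| / N < ρ) →
        (∀ n n' : ℤ, |ψ n - ψ n'| ≤
          (⨆ i : Fin k, ‖((((n - n' : ℤ) : ℝ) * α i : ℝ) : AddCircle (1 : ℝ))‖) +
            |((n - n' : ℤ) : ℝ)| / N) →
      ∀ δ : ℝ, 0 < δ → δ ≤ 1 → ∃ J : ℕ, 1 ≤ J ∧ (J : ℝ) ≤ Cf / δ ^ D ∧
        ∃ (c : ℕ → ℂ) (β : ℕ → ℝ), (∀ j, ‖c j‖ ≤ 1) ∧ ∀ n : ℤ,
          (⨆ i : Fin k, ‖((((n - n₀ : ℤ) : ℝ) * α i : ℝ) : AddCircle (1 : ℝ))‖) +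
              |((n - n₀ : ℤ) : ℝ)| / N < 3 * ρ →
            ‖((ψ n : ℝ) : ℂ) - ∑ j ∈ range J, c j * (𝐞 (β j * (n : ℝ)) : ℂ)‖ ≤ δ) :
    ∃ (A₂ : ℕ) (C₂ : ℝ), 1 ≤ C₂ ∧ ∀ (N : ℕ), 2 ≤ N →
      ∀ (α : Fin k → ℝ) (n₀ : ℤ) (ρ : ℝ), 0 < ρ → 100000 * ρ < 1 →
      ∀ (φ : ℤ → UnitAddCircle),
        (∀ n a b c : ℤ,
          (⨆ i : Fin k, ‖((((n - n₀ : ℤ) : ℝ) * α i : ℝ) : AddCircle (1 : ℝ))‖) +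
              |((n - n₀ : ℤ) : ℝ)| / N < 100 * ρ →
          (⨆ i : Fin k, ‖((((n + a - n₀ : ℤ) : ℝ) * α i : ℝ) : AddCircle (1 : ℝ))‖) +
              |((n + a - n₀ : ℤ) : ℝ)| / N < 100 * ρ →
          (⨆ i : Fin k, ‖((((n + b - n₀ : ℤ) : ℝ) * α i : ℝ) : AddCircle (1 : ℝ))‖) +
              |((n + b - n₀ : ℤ) : ℝ)| / N < 100 * ρ →
          (⨆ i : Fin k, ‖((((n + c - n₀ : ℤ) : ℝ) * α i : ℝ) : AddCircle (1 : ℝ))‖) +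
              |((n + c - n₀ : ℤ) : ℝ)| / N < 100 * ρ →
          (⨆ i : Fin k, ‖((((n + a + b - n₀ : ℤ) : ℝ) * α i : ℝ) : AddCircle (1 : ℝ))‖) +
              |((n + a + b - n₀ : ℤ) : ℝ)| / N < 100 * ρ →
          (⨆ i : Fin k, ‖((((n + a + c - n₀ : ℤ) : ℝ) * α i : ℝ) : AddCircle (1 : ℝ))‖) +
              |((n + a + c - n₀ : ℤ) : ℝ)| / N < 100 * ρ →
          (⨆ i : Fin k, ‖((((n + b + c - n₀ : ℤ) : ℝ) * α i : ℝ) : AddCircle (1 : ℝ))‖) +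
              |((n + b + c - n₀ : ℤ) : ℝ)| / N < 100 * ρ →
          (⨆ i : Fin k, ‖((((n + a + b + c - n₀ : ℤ) : ℝ) * α i : ℝ) : AddCircle (1 : ℝ))‖) +
              |((n + a + b + c - n₀ : ℤ) : ℝ)| / N < 100 * ρ →
          φ (n + a + b + c) - φ (n + a + b) - φ (n + a + c) - φ (n + b + c)
            + φ (n + a) + φ (n + b) + φ (n + c) - φ n = 0) →
      ∀ (ψ : ℤ → ℝ), (∀ n, 0 ≤ ψ n) → (∀ n, ψ n ≤ 1) →
        (∀ n, ψ n ≠ 0 →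
          (⨆ i : Fin k, ‖((((n - n₀ : ℤ) : ℝ) * α i : ℝ) : AddCircle (1 : ℝ))‖) +
            |((n - n₀ : ℤ) : ℝ)| / N < ρ) →
        (∀ n, ψ n ≠ 0 → (N : ℤ) < n ∧ n ≤ 2 * N) →
        (∀ n n' : ℤ, |ψ n - ψ n'| ≤
          (⨆ i : Fin k, ‖((((n - n' : ℤ) : ℝ) * α i : ℝ) : AddCircle (1 : ℝ))‖) +
            |((n - n' : ℤ) : ℝ)| / N) →
      ∀ (η : ℝ), 0 < η → η ≤ 1 →
      ∀ (K w' : ℕ), C₂ / η ^ A₂ ≤ (K : ℝ) → C₂ / η ^ A₂ ≤ ((2 * N / K : ℕ) : ℝ) → K ≤ N →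
        w' ∈ Icc 1 (2 * N / K) →
        η * ((2 * N / K : ℕ) : ℝ) - 1 ≤ #((Icc 1 (2 * N / K)).filter fun w => w ≠ w' ∧
          η * K ≤ ‖∑ d ∈ Ioc K (min (2 * K) (min (2 * N / w) (2 * N / w'))),
            ((ψ ((d * w : ℕ) : ℤ) : ℝ) : ℂ) * (AddCircle.toCircle (φ ((d * w : ℕ) : ℤ)) : ℂ) *
              conj (((ψ ((d * w' : ℕ) : ℤ) : ℝ) : ℂ) *
                (AddCircle.toCircle (φ ((d * w' : ℕ) : ℤ)) : ℂ))‖) →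
      ∀ (s t : ℤ) (L M : ℕ),
        (L : ℝ) * |(s : ℝ)| ≤ η ^ A₂ / C₂ * K →
        (M : ℝ) * |(t : ℝ)| ≤ η ^ A₂ / C₂ * ((2 * N / K : ℕ) : ℝ) →
        C₂ / η ^ A₂ ≤ (L : ℝ) → C₂ / η ^ A₂ ≤ (M : ℝ) →
        (L : ℝ) * (M : ℝ) *
            ((⨆ i : Fin k, ‖((((s * t : ℤ) : ℝ) * α i : ℝ) : AddCircle (1 : ℝ))‖) +
              |((s * t : ℤ) : ℝ)| / N) ≤ (η ^ A₂ / C₂) ^ 2 →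
        (L : ℝ) * (M : ℝ) *
            ((⨆ i : Fin k, ‖((((s * t : ℤ) : ℝ) * α i : ℝ) : AddCircle (1 : ℝ))‖) +
              |((s * t : ℤ) : ℝ)| / N) ≤ ρ →
        ∃ q : ℕ, 1 ≤ q ∧ (q : ℝ) ≤ C₂ / η ^ A₂ ∧
          ‖q • (φ (n₀ + s * t + s * t) - φ (n₀ + s * t) - φ (n₀ + s * t) + φ n₀)‖ ≤
            C₂ / η ^ A₂ / ((L : ℝ) ^ 2 * (M : ℝ) ^ 2) := by
  classical
  obtain ⟨D, Cf, hCf, hF⟩ := hfour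
  have hCfpos : 0 < Cf := by linarith
  set c₁ : ℝ := 1 / ((4096 : ℝ) ^ 4 * 3 ^ 10) with hc₁
  have hc₁pos : 0 < c₁ := by rw [hc₁]; positivity
  have hc₁1 : c₁ ≤ 1 := by rw [hc₁, div_le_one (by positivity)]; norm_num
  set B : ℝ := 2 ^ (D + 1) * Cf / c₁ ^ (D + 1) with hB
  have hBpos : 0 < B := by rw [hB]; positivity
  have hB1 : 1 ≤ B := by
    rw [hB, le_div_iff₀ (by positivity)]
    have h1 : c₁ ^ (D + 1) ≤ 1 := pow_le_one₀ hc₁pos.le hc₁1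
    have h2 : (1 : ℝ) ≤ 2 ^ (D + 1) := one_le_pow₀ (by norm_num)
    nlinarith
  refine ⟨40448 * (D + 1), 10 ^ 200 * B ^ 1264, ?_, ?_⟩
  · exact one_le_mul_of_one_le_of_one_le (by norm_num) (one_le_pow₀ hB1)
  intro N h2N α n₀ ρ hρ hρ1 φ hφ ψ hψ0 hψ1 hsupp hsuppN hlip η hη hη1 K w' hKbig hWbig hKN hw'
    hgood s t L M hs ht hLbig hMbig hst1 hst2
  -- the budget `Q = C₂ / η^{A₂}`
  have hηA : 0 < η ^ (40448 * (D + 1)) := by positivity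
  have hηA1 : η ^ (40448 * (D + 1)) ≤ 1 := pow_le_one₀ hη.le hη1
  have hC₂ : (10 : ℝ) ^ 200 ≤ 10 ^ 200 * B ^ 1264 :=
    le_mul_of_one_le_right (by positivity) (one_le_pow₀ hB1)
  have hQ : 10 ^ 200 * B ^ 1264 ≤ 10 ^ 200 * B ^ 1264 / η ^ (40448 * (D + 1)) := by
    rw [le_div_iff₀ hηA]
    exact mul_le_of_le_one_right (by positivity) hηA1
  have h2C : (2 : ℝ) ≤ 10 ^ 200 := by norm_num
  have hQ2 : (2 : ℝ) ≤ 10 ^ 200 * B ^ 1264 / η ^ (40448 * (D + 1)) := h2C.trans (hC₂.trans hQ)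
  have hK1 : 1 ≤ K := by
    have : (1 : ℝ) ≤ K := by linarith
    exact_mod_cast this
  have hL1 : 1 ≤ L := by
    have : (1 : ℝ) ≤ L := by linarith
    exact_mod_cast this
  have hM1 : 1 ≤ M := by
    have : (1 : ℝ) ≤ M := by linarith
    exact_mod_cast this
  -- `εK ≤ K/2`, `εW ≤ W/2`
  have hε2 : η ^ (40448 * (D + 1)) / (10 ^ 200 * B ^ 1264) ≤ 1 / 2 := by
    rw [div_le_div_iff₀ (by positivity) (by norm_num)]
    linarith
  have hs' : (L : ℝ) * |(s : ℝ)| ≤ (K : ℝ) / 2 := by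
    refine hs.trans ?_
    have := mul_le_mul_of_nonneg_right hε2 (Nat.cast_nonneg K)
    linarith
  have ht' : (M : ℝ) * |(t : ℝ)| ≤ ((2 * N / K : ℕ) : ℝ) / 2 := by
    refine ht.trans ?_
    have := mul_le_mul_of_nonneg_right hε2 (Nat.cast_nonneg (2 * N / K))
    linarith
  -- `2 ≤ ηW`
  have hηW : 2 ≤ η * ((2 * N / K : ℕ) : ℝ) := by
    have hηpow : η ^ (40448 * (D + 1)) ≤ η := by
      calc η ^ (40448 * (D + 1)) ≤ η ^ 1 := pow_le_pow_of_le_one hη.le hη1 (by omega)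
        _ = η := pow_one η
    have h1 : 10 ^ 200 * B ^ 1264 ≤ η * (10 ^ 200 * B ^ 1264 / η ^ (40448 * (D + 1))) := by
      rw [mul_div_assoc', le_div_iff₀ hηA]
      have := mul_le_mul_of_nonneg_left hηpow (show (0 : ℝ) ≤ 10 ^ 200 * B ^ 1264 by positivity)
      linarith
    have h2 := mul_le_mul_of_nonneg_left hWbig hη.le
    have : (2 : ℝ) ≤ 10 ^ 200 := by norm_num
    linarith
  -- the Fourier expansion at this data
  have hfourN := hF N α n₀ ρ hρ ψ hψ0 hψ1 hsupp hlip
  -- the level `η'` of `lemma24_core` is `η^{32(D+1)}/B`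
  have hE : c₁ ^ (D + 1) * η ^ (32 * (D + 1)) / (2 ^ (D + 1) * Cf) = η ^ (32 * (D + 1)) / B := by
    rw [hB]; field_simp
  have hEpow : ∀ a b : ℕ, ((η ^ (32 * (D + 1)) / B) ^ a) ^ b =
      η ^ (32 * (D + 1) * (a * b)) / B ^ (a * b) := by
    intro a b; rw [← pow_mul, div_pow, ← pow_mul]
  -- comparison of budgets: `10^e₀ B^m / η^{32(D+1)m} ≤ Q` for `m ≤ 1264`, `e₀ ≤ 200`
  have hbudget : ∀ (e₀ m : ℕ), e₀ ≤ 200 → m ≤ 1264 →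
      (10 : ℝ) ^ e₀ * B ^ m / η ^ (32 * (D + 1) * m) ≤
        10 ^ 200 * B ^ 1264 / η ^ (40448 * (D + 1)) := by
    intro e₀ m he hm
    have h1 : (10 : ℝ) ^ e₀ * B ^ m ≤ 10 ^ 200 * B ^ 1264 :=
      mul_le_mul (pow_le_pow_right₀ (by norm_num) he) (pow_le_pow_right₀ hB1 hm)
        (by positivity) (by positivity)
    have h2 : η ^ (40448 * (D + 1)) ≤ η ^ (32 * (D + 1) * m) :=
      pow_le_pow_of_le_one hη.le hη1 (by nlinarith)
    calc (10 : ℝ) ^ e₀ * B ^ m / η ^ (32 * (D + 1) * m)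
        ≤ 10 ^ 200 * B ^ 1264 / η ^ (32 * (D + 1) * m) :=
          div_le_div_of_nonneg_right h1 (by positivity)
      _ ≤ 10 ^ 200 * B ^ 1264 / η ^ (40448 * (D + 1)) :=
          div_le_div_of_nonneg_left (by positivity) hηA h2
  -- largeness hypotheses of `lemma24_core`
  have hnL : (L : ℝ) ≤ (((L : ℤ) - (-(L : ℤ)) + 1 : ℤ) : ℝ) := by push_cast; linarith
  have hnM : (M : ℝ) ≤ (((M : ℤ) - (-(M : ℤ)) + 1 : ℤ) : ℝ) := by push_cast; linarith
  have hbig : (10 : ℝ) ^ 50 / ((c₁ ^ (D + 1) * η ^ (32 * (D + 1)) / (2 ^ (D + 1) * Cf)) ^ 16) ^ 34 ≤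
      10 ^ 200 * B ^ 1264 / η ^ (40448 * (D + 1)) := by
    rw [hE, hEpow, div_div_eq_mul_div]
    exact hbudget 50 (16 * 34) (by norm_num) (by norm_num)
  have hLbig' := hbig.trans (hLbig.trans hnL)
  have hMbig' := hbig.trans (hMbig.trans hnM)
  -- Lemma 24 composed
  obtain ⟨q, hq1, hqQ, hqb⟩ := lemma24_core k α n₀ hρ φ hCf hφ ψ hψ0 hψ1 hsupp hsuppN hfourN η hη
    hη1 K w' hK1 hw' hηW hgood s t L M hL1 hM1 hs' ht' hst2 hLbig' hMbig'
  refine ⟨q, hq1, ?_, ?_⟩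
  · refine hqQ.trans ?_
    rw [hE, hEpow]
    have e : (2 : ℝ) * (10 ^ 70 / (η ^ (32 * (D + 1) * (16 * 26)) / B ^ (16 * 26))) =
        2 * 10 ^ 70 * B ^ (16 * 26) / η ^ (32 * (D + 1) * (16 * 26)) := by
      field_simp
    rw [e]
    calc (2 : ℝ) * 10 ^ 70 * B ^ (16 * 26) / η ^ (32 * (D + 1) * (16 * 26))
        ≤ 10 ^ 71 * B ^ (16 * 26) / η ^ (32 * (D + 1) * (16 * 26)) := by
          refine div_le_div_of_nonneg_right ?_ (by positivity)
          refine mul_le_mul_of_nonneg_right (by norm_num) (by positivity)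
      _ ≤ 10 ^ 200 * B ^ 1264 / η ^ (40448 * (D + 1)) :=
          hbudget 71 (16 * 26) (by norm_num) (by norm_num)
  · refine hqb.trans ?_
    rw [hE, hEpow]
    have hLr : (0 : ℝ) < L := by exact_mod_cast hL1
    have hMr : (0 : ℝ) < M := by exact_mod_cast hM1
    have hsq : (L : ℝ) ^ 2 * (M : ℝ) ^ 2 ≤
        (((L : ℤ) - (-(L : ℤ)) + 1 : ℤ) : ℝ) ^ 2 * (((M : ℤ) - (-(M : ℤ)) + 1 : ℤ) : ℝ) ^ 2 :=
      mul_le_mul (pow_le_pow_left₀ hLr.le hnL 2) (pow_le_pow_left₀ hMr.le hnM 2)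
        (by positivity) (by positivity)
    have hexp : 32 * (D + 1) * (16 * 79) = 40448 * (D + 1) := by ring
    rw [hexp, show (16 * 79 : ℕ) = 1264 by norm_num]
    -- `10^200 / ((η^A/B^1264) * n²) = (10^200 B^1264/η^A) / n² ≤ Q / (L²M²)`
    have e : (10 : ℝ) ^ 200 / (η ^ (40448 * (D + 1)) / B ^ 1264 *
        ((((L : ℤ) - (-(L : ℤ)) + 1 : ℤ) : ℝ) ^ 2 * (((M : ℤ) - (-(M : ℤ)) + 1 : ℤ) : ℝ) ^ 2)) =
        (10 ^ 200 * B ^ 1264 / η ^ (40448 * (D + 1))) /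
          ((((L : ℤ) - (-(L : ℤ)) + 1 : ℤ) : ℝ) ^ 2 * (((M : ℤ) - (-(M : ℤ)) + 1 : ℤ) : ℝ) ^ 2) := by
      field_simp
    rw [e]
    exact div_le_div_of_nonneg_left (by positivity) (by positivity) hsq

end Summit.Parity.GeneralizedHardyLittlewood.GreenTaoLevelTwoMNTwoLemma24Poly
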